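/-
Copyright (c) 2026 the pub-hodgecm-mathlib formalisation cell (harness21).  Prover seat hodgecm-mathlib-R90-C14-p01 (g0), R90-TF section S8 «ContSpec-n½» (dealer R90-CS-plan (g0),
hand T2-(ii), 2026-09-04), h413 = `stmt-HodgeConjecture-24833`: the LEVEL-`K′` twin of ★ p12 `K2E1ContinuedEisensteinResidueFunctionUTwo` §2–§3 — the Siegel-top formula in TOP-COSET form,
the pointwise limit `(z−1)·Λ^T Ẽ(z)(y) → F y 1 − 𝟙[T < w(y)]·r`, and `Res_T =ᵐ Res Ẽ − r·𝟙_{T<w₁}` for an ARBITRARY section (letter (L-AE) of the T1 assembly).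
-/
import Summits.HodgeConjecture.HodgeConjecture.Theorems.K2E1ContinuedEisensteinResidueFunctionUTwo     -- ★ the `φ₀`-typed original: §1 `continuous_residueValue`, `residueValue_rational_mul`; §2 `truncation_continued_apply`; §3 `ae_eq_residueValue_sub_indicator`
import HarnessLib

/-!
# K2·E1 ∕ R90-TF S8 — `K2E1ContinuedEisensteinResidueFunctionLevelUTwo` (hand T2-(ii) of `Theorems/K2E1EisensteinResidueLevelConstantU2.lean`, `U(J₂)_{E/F}`): THE SIEGEL-TOP FORMULA IN
# TOP-COSET FORM, `(z−1)·Λ^T Ẽ(z)(y) → F y 1 − 𝟙[T < w(y)]·r`, AND `Res_T =ᵐ [Res Ẽ] − r·[𝟙_{T<w₁}]` FOR A LEVEL-`K′` SECTION — the letter (L-AE)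

Track B ∕ K2-LIT inside programme R90-TF (brief `director/R90-BRIEF.v2.md` 1f40d54518340a35), section S8 = continuous spectrum ∕ `n = ½` (base `R90-CS`), crux h413 =
`stmt-HodgeConjecture-24833`, route of record `HCCMUnconditional`; cell `hodgecm-mathlib`.  Prover seat `hodgecm-mathlib-R90-C14-p01` (g0), hand T2-(ii) of the dealer R90-CS-plan (g0)
(R90 bus 2026-09-04T16:08:13Z ∕ 16:09:24Z, ruling S8-R9), census of K2E1-p10 (g3) (16:05:37Z).  THEOREMS ONLY (no `def`, no `instance`, no notation, no named-fact hypothesis, no `sorry`);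
lane `--supports stmt-HodgeConjecture-24833 --as helper` (count-neutral).  Closes no socket.  Companion of ★ `K2E1ContinuedEisensteinResidueConstantTermLevelUTwo` (hand T2-(i), letter (L-CT)).

THE MATHEMATICS ([MoeglinWaldspurger1995, IV.1.11, I.2.13]; [Langlands1976, §7]; [BernsteinLapid2019, §4 p. 10]).  ★ `K2E1ContinuedEisensteinResidueFunctionUTwo` §2 writes the Siegel-top
formula `Λ^T u(y) = u(y) − 𝟙[T < w(y)]·Φ(w(y))` for functions `u` whose constant term is a FUNCTION `Φ` OF THE HEIGHT — true for the `K_max`-spherical section (`Ẽ(z)_B = φ₀(H^z + c̃(z)H^{1−z})`)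
but FALSE at level `K′`: the constant term `Ẽ(z)_B(g) = φ₁(g)·H(g)^z + ψ(z, g)·H(g)^{1−z}` ([MoeglinWaldspurger1995, II.1.7]) depends on `g` through the section, not only through `H(g)`.
The honest general form is the TOP-COSET form: for every left-`G(F)`-invariant `u`, `T ≥ 1` and any `γ₀ ∈ G(F)` maximising `γ ↦ H(γy)` (★ `K2E1BLHeightCosetsU2.exists_forall_borelHeight_mul_le`:
`w(y) = max_γ H(γy)` is attained), `Λ^T u(y) = u(y) − 𝟙[T < w(y)]·u_B(γ₀y)` (above the floor only the top coset contributes, ★ `truncation_eq_self_sub_borelConstantTerm_of_rational_invariant_two`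
with ★ `truncation_rational_mul`; below it nothing does, ★ `truncation_apply_eq_self_of_forall_borelHeight_le`).  Reading the level-`K′` letter at `g = γ₀y` and using the pole letters
`F y =ᶠ (z−1)Ẽ(z)(y)` (analytic at `1`) and `(z−1)ψ(z, g) → r` with ONE constant `r` for EVERY `g` (here is where the uniformity in `g` is used: the top coset `γ₀` depends on `y`),
`(z−1)·Λ^T Ẽ(z)(y) = F y z − 𝟙[T<w(y)]·(φ₁(γ₀y)(z−1)H(γ₀y)^z + (z−1)ψ(z,γ₀y)·H(γ₀y)^{1−z}) → F y 1 − 𝟙[T<w(y)]·(0 + r·1)`.  §3 is then ★ §3 verbatim: an `L²` limit is an a.e. limit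
along a sequence (Mathlib `tendstoInMeasure_of_tendsto_Lp`, `TendstoInMeasure.exists_seq_tendsto_ae'`).
* §1 **`ciSup_borelHeight_arith_mul_eq`**, **`truncation_apply_top_coset`** — `w(y) = H(γ₀y)` and the Siegel-top formula in top-coset form (any left-`G(F)`-invariant `u`, rank `2`).
* §2 **`tendsto_sub_one_mul_truncation_continued_level`** — `(z−1)·Λ^T Ẽ(z)(y) → F y 1 − 𝟙[T < w(y)]·r`.
* §3 **`ae_eq_residueValue_sub_indicator_level`** — `Res_T =ᵐ (x ↦ F x̃⁻¹ 1 − 𝟙[T < w₁ x]·r)`: the letter (L-AE) of the T1 assembly ★ `K2E1EisensteinResidueLevelConstantU2` (K2E1-p10 (g3)),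
  in the shape of ★ `ae_eq_residueValue_sub_indicator` with `φ₀·r ↦ r` token-for-token.
HONEST LABEL: HC_CM is proved only modulo the 7 printed citations (2 remaining named inputs: hLiu418 = `stmt-HodgeConjecture-24832`, h413 = `stmt-HodgeConjecture-24833`) until rung 0
closes; this file asserts no named fact and closes no socket; §2–§3 are CONDITIONAL on the level-`K′` constant-term letter (E3′-K′), the pole letters (F) and `(z−1)ψ(z, g) → r`, and (§3) the
operator road's `L²` family.
References: [MoeglinWaldspurger1995] I.2.13, II.1.7, IV.1.11 · [Langlands1976] §7 · [BernsteinLapid2019] §4 p. 10 · [Garrett2018] §2.10–§2.11.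
-/

set_option autoImplicit false
-- the mandated namespace repeats the single-problem summit's segment (`HodgeConjecture.HodgeConjecture`)
set_option linter.dupNamespace false

noncomputable section

open MeasureTheory Measure NumberField IsDedekindDomain Set Filter Topology Metric
open scoped ENNReal NNReal
open Literature.NumberTheory.Automorphic Literature.NumberTheory.Automorphic.UnitaryGroup AdelicGroupData
open Summit.HodgeConjecture.HodgeConjecture.Cruxes.H413.K2E1BLBorelSpacesU2Defs
open Summit.HodgeConjecture.HodgeConjecture.Cruxes.H413.K2E1BLEisensteinInWeightedSpaceU2Weights (supHeight_eq_ciSup_arithmetic)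
open Summit.HodgeConjecture.HodgeConjecture.Cruxes.H413.K2E1BLHeckeOperatorWeightedU2 (bddAbove_range_borelHeight_arith_mul)
open Summit.HodgeConjecture.HodgeConjecture.Cruxes.H413.K2E1BLHeightCosetsU2 (exists_forall_borelHeight_mul_le)
open Summit.HodgeConjecture.HodgeConjecture.Cruxes.H413.K2E1TruncatedEisensteinL2 (truncation_apply_eq_self_of_forall_borelHeight_le)
open Summit.HodgeConjecture.HodgeConjecture.Cruxes.H413.K2E1ContinuedEisensteinResidueFunctionUTwo

namespace Summit.HodgeConjecture.HodgeConjecture.Cruxes.H413.K2E1ContinuedEisensteinResidueFunctionLevelUTwo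

/-! ## §1 The Siegel-top formula in top-coset form (any left-`G(F)`-invariant `u`, `U(J₂)`) -/

section SiegelTop

variable {F E : Type} [Field F] [NumberField F] [Field E] [NumberField E] [Algebra F E] {c : E ≃ₐ[F] E}

/-- **`w(y) = H(γ₀y)` for a height-maximising `γ₀`** (`w(y) = ⨆_γ H(γy)` over `G(F)`; the family is bounded above ★ and the bound is attained ★). [cite: BernsteinLapid2019, §4 (p. 10)] -/
theorem ciSup_borelHeight_arith_mul_eq {γ₀ : (quasiSplit F E c 2).arithmeticSubgroup} {y : (quasiSplit F E c 2).Adelic}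
    (hγ₀ : ∀ γ : (quasiSplit F E c 2).arithmeticSubgroup, borelHeight ((γ : (quasiSplit F E c 2).Adelic) * y) ≤ borelHeight ((γ₀ : (quasiSplit F E c 2).Adelic) * y)) :
    (⨆ γ : (quasiSplit F E c 2).arithmeticSubgroup, borelHeight ((γ : (quasiSplit F E c 2).Adelic) * y)) = borelHeight ((γ₀ : (quasiSplit F E c 2).Adelic) * y) :=
  le_antisymm (ciSup_le hγ₀) (le_ciSup (bddAbove_range_borelHeight_arith_mul y) γ₀)

variable [MeasurableSpace (quasiSplit F E c 2).Adelic] [BorelSpace (quasiSplit F E c 2).Adelic]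

/-- **THE SIEGEL-TOP FORMULA, TOP-COSET FORM**: for `T ≥ 1`, a left-`G(F)`-invariant `u`, every `y` and any `γ₀ ∈ G(F)` maximising `γ ↦ H(γy)`:
`Λ^T u(y) = u(y) − 𝟙[T < H(γ₀y)]·u_B(γ₀y)` (`Λ^T` is `G(F)`-invariant ★, above the floor only the top coset contributes ★, below it nothing does ★).  No hypothesis on the SHAPE of the
constant term (contrast ★ `truncation_continued_apply`, which needs `u_B = Φ ∘ H`). [cite: MoeglinWaldspurger1995, I.2.13] [cite: Garrett2018, §2.10–§2.11] -/
theorem truncation_apply_top_coset (ν : Measure ↥(adelicUnipotent F E c 2)) [ν.IsHaarMeasure] {𝓕 : Set ↥(adelicUnipotent F E c 2)}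
    (h𝓕 : IsFundamentalDomain ↥(rationalUnipotent F E c 2) 𝓕 ν) {T : ℝ≥0} (hT : 1 ≤ T) {u : (quasiSplit F E c 2).Adelic → ℂ}
    (hu : ∀ (γ : (quasiSplit F E c 2).arithmeticSubgroup) (x : (quasiSplit F E c 2).Adelic), u ((γ : (quasiSplit F E c 2).Adelic) * x) = u x)
    {γ₀ : (quasiSplit F E c 2).arithmeticSubgroup} {y : (quasiSplit F E c 2).Adelic}
    (hγ₀ : ∀ γ : (quasiSplit F E c 2).arithmeticSubgroup, borelHeight ((γ : (quasiSplit F E c 2).Adelic) * y) ≤ borelHeight ((γ₀ : (quasiSplit F E c 2).Adelic) * y)) :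
    truncation ν 𝓕 T u y = u y - if T < borelHeight ((γ₀ : (quasiSplit F E c 2).Adelic) * y) then
      borelConstantTerm ν 𝓕 u ((γ₀ : (quasiSplit F E c 2).Adelic) * y) else 0 := by
  by_cases h : T < borelHeight ((γ₀ : (quasiSplit F E c 2).Adelic) * y)
  · rw [if_pos h, ← truncation_rational_mul ν h𝓕 T hu γ₀ y, truncation_eq_self_sub_borelConstantTerm_of_rational_invariant_two ν h𝓕 hu hT h, hu]
  · rw [if_neg h, sub_zero]
    exact truncation_apply_eq_self_of_forall_borelHeight_le ν 𝓕 u fun δ => (hγ₀ δ).trans (not_lt.1 h)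

/-! ## §2 The pointwise limit of `(z−1)·Λ^T Ẽ(z)` for a level-`K′` section -/

/-- **THE POINTWISE LIMIT `(z−1)·Λ^T Ẽ(z)(y) → F y 1 − 𝟙[T < w(y)]·r` — LEVEL-`K′` SECTIONS** (`z → 1`, `z ≠ 1`): the Siegel-top formula in top-coset form with the level-`K′` continued
constant term `Ẽ(z)_B(g) = φ₁(g)H(g)^z + ψ(z, g)H(g)^{1−z}` ((E3′-K′)) read at the top coset `g = γ₀y`, `(z−1)Ẽ(z)(y) = F y z → F y 1` (the pole letter), `(z−1)H^z → 0`, `(z−1)ψ(z, γ₀y) → r`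
(ONE `r` for every `g`), `H^{1−z} → 1`. [cite: MoeglinWaldspurger1995, IV.1.11] [cite: Langlands1976, §7] -/
theorem tendsto_sub_one_mul_truncation_continued_level (ν : Measure ↥(adelicUnipotent F E c 2)) [ν.IsHaarMeasure] {𝓕 : Set ↥(adelicUnipotent F E c 2)}
    (h𝓕 : IsFundamentalDomain ↥(rationalUnipotent F E c 2) 𝓕 ν) {T : ℝ≥0} (hT : 1 ≤ T) (φ₁ : (quasiSplit F E c 2).Adelic → ℂ)
    (Ec : ℂ → (quasiSplit F E c 2).Adelic → ℂ) {D : Set ℂ} (hD1 : ∀ᶠ z in 𝓝[≠] (1 : ℂ), z ∈ D)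
    (hEcinv : ∀ z ∈ D, ∀ (γ : (quasiSplit F E c 2).arithmeticSubgroup) (x : (quasiSplit F E c 2).Adelic), Ec z ((γ : (quasiSplit F E c 2).Adelic) * x) = Ec z x)
    (ψ : ℂ → (quasiSplit F E c 2).Adelic → ℂ) {r : ℂ} (hψ : ∀ g : (quasiSplit F E c 2).Adelic, Tendsto (fun z : ℂ => (z - 1) * ψ z g) (𝓝[≠] 1) (𝓝 r))
    (hE3 : ∀ z ∈ D, ∀ g : (quasiSplit F E c 2).Adelic,
      borelConstantTerm ν 𝓕 (Ec z) g = φ₁ g * (((borelHeight g : ℝ≥0) : ℝ) : ℂ) ^ z + ψ z g * (((borelHeight g : ℝ≥0) : ℝ) : ℂ) ^ (1 - z))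
    (Fp : (quasiSplit F E c 2).Adelic → ℂ → ℂ) (hF : ∀ g, AnalyticAt ℂ (Fp g) 1) (hFE : ∀ g, Fp g =ᶠ[𝓝[≠] 1] fun z => (z - 1) * Ec z g)
    (y : (quasiSplit F E c 2).Adelic) :
    Tendsto (fun z : ℂ => (z - 1) * truncation ν 𝓕 T (Ec z) y) (𝓝[≠] 1)
      (𝓝 (Fp y 1 - if T < ⨆ γ : (quasiSplit F E c 2).arithmeticSubgroup, borelHeight ((γ : (quasiSplit F E c 2).Adelic) * y) then r else 0)) := by
  -- the top coset `γ₀`, `w(y) = H(γ₀y)`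
  obtain ⟨γ₀, hγ₀⟩ := exists_forall_borelHeight_mul_le (F := F) (E := E) (c := c) y
  rw [ciSup_borelHeight_arith_mul_eq hγ₀]
  -- the Siegel-top formula along the filter, with the level-`K′` constant term read at `γ₀y`
  have heq : (fun z : ℂ => (z - 1) * truncation ν 𝓕 T (Ec z) y) =ᶠ[𝓝[≠] 1] fun z =>
      Fp y z - if T < borelHeight ((γ₀ : (quasiSplit F E c 2).Adelic) * y) then
        φ₁ ((γ₀ : (quasiSplit F E c 2).Adelic) * y) * ((z - 1) * (((borelHeight ((γ₀ : (quasiSplit F E c 2).Adelic) * y) : ℝ≥0) : ℝ) : ℂ) ^ z) +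
          ((z - 1) * ψ z ((γ₀ : (quasiSplit F E c 2).Adelic) * y)) * (((borelHeight ((γ₀ : (quasiSplit F E c 2).Adelic) * y) : ℝ≥0) : ℝ) : ℂ) ^ (1 - z) else 0 := by
    filter_upwards [hD1, hFE y] with z hzD hzF
    rw [truncation_apply_top_coset ν h𝓕 hT (hEcinv z hzD) hγ₀, hE3 z hzD, hzF, mul_sub]
    congr 1
    split_ifs
    · ring
    · rw [mul_zero]
  refine Tendsto.congr' heq.symm ?_
  have hF2 : Tendsto (Fp y) (𝓝[≠] 1) (𝓝 (Fp y 1)) := tendsto_nhdsWithin_of_tendsto_nhds (hF y).continuousAt.tendsto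
  refine hF2.sub ?_
  split_ifs with hTW
  · -- `H(γ₀y) > T ≥ 1 > 0`
    have hW0 : (((borelHeight ((γ₀ : (quasiSplit F E c 2).Adelic) * y) : ℝ≥0) : ℝ) : ℂ) ≠ 0 := by
      exact_mod_cast (borelHeight_pos ((γ₀ : (quasiSplit F E c 2).Adelic) * y)).ne'
    have hcpow : ContinuousAt (fun z : ℂ => (((borelHeight ((γ₀ : (quasiSplit F E c 2).Adelic) * y) : ℝ≥0) : ℝ) : ℂ) ^ z) 1 := continuousAt_const_cpow hW0
    have h1 : Tendsto (fun z : ℂ => φ₁ ((γ₀ : (quasiSplit F E c 2).Adelic) * y) * ((z - 1) * (((borelHeight ((γ₀ : (quasiSplit F E c 2).Adelic) * y) : ℝ≥0) : ℝ) : ℂ) ^ z)) (𝓝[≠] 1)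
        (𝓝 (φ₁ ((γ₀ : (quasiSplit F E c 2).Adelic) * y) * (0 * (((borelHeight ((γ₀ : (quasiSplit F E c 2).Adelic) * y) : ℝ≥0) : ℝ) : ℂ) ^ (1 : ℂ)))) := by
      refine tendsto_nhdsWithin_of_tendsto_nhds (Tendsto.const_mul _ (Tendsto.mul ?_ hcpow.tendsto))
      have : Tendsto (fun z : ℂ => z - 1) (𝓝 1) (𝓝 (1 - 1)) := tendsto_id.sub tendsto_const_nhds
      rwa [sub_self] at this
    have h2 : Tendsto (fun z : ℂ => ((z - 1) * ψ z ((γ₀ : (quasiSplit F E c 2).Adelic) * y)) * (((borelHeight ((γ₀ : (quasiSplit F E c 2).Adelic) * y) : ℝ≥0) : ℝ) : ℂ) ^ (1 - z))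
        (𝓝[≠] 1) (𝓝 (r * (((borelHeight ((γ₀ : (quasiSplit F E c 2).Adelic) * y) : ℝ≥0) : ℝ) : ℂ) ^ ((1 : ℂ) - 1))) :=
      (hψ _).mul (tendsto_nhdsWithin_of_tendsto_nhds ((continuousAt_const_cpow hW0).comp_of_eq (continuousAt_const.sub continuousAt_id) rfl).tendsto)
    have h := h1.add h2
    simp only [zero_mul, mul_zero, zero_add, sub_self, Complex.cpow_zero, mul_one] at h
    exact h
  · exact tendsto_const_nhds

end SiegelTop

/-! ## §3 The `L²` residue class is the residue function minus `r` times the Siegel indicator, almost everywhere (letter (L-AE)) -/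

section AE

variable {F E : Type} [Field F] [NumberField F] [Field E] [NumberField E] [Algebra F E] {c : E ≃ₐ[F] E}
variable [MeasurableSpace (quasiSplit F E c 2).Adelic] [BorelSpace (quasiSplit F E c 2).Adelic]

/-- **`Res_T =ᵐ Res Ẽ − r·𝟙_{T<w₁}` — LEVEL-`K′` SECTIONS** (letter (L-AE) of the T1 assembly ★ `K2E1EisensteinResidueLevelConstantU2`): if `F_T : ℂ → L²(μ)` satisfies `F_T(z) =ᵐ Λ^T Ẽ(z)` on
`D` and `(z−1)•F_T(z) → Res_T` in `L²(μ)` (`z → 1`, `z ≠ 1`), where the continued constant term is the level-`K′` letter `Ẽ(z)_B(g) = φ₁(g)H(g)^z + ψ(z, g)H(g)^{1−z}` with `(z−1)ψ(z, g) → r`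
for every `g`, then for `μ`-a.e. `x = [g]`: `Res_T(x) = F g̃⁻¹ 1 − 𝟙[T < w₁(x)]·r` — an `L²` limit is an a.e. limit along a sequence, and the pointwise limit is §2.  Shape of ★
`ae_eq_residueValue_sub_indicator` with `φ₀·r ↦ r`. [cite: MoeglinWaldspurger1995, IV.1.11] [cite: BernsteinLapid2019, §4 p. 10] -/
theorem ae_eq_residueValue_sub_indicator_level (μ : Measure (quasiSplit F E c 2).automorphicQuotient)
    (ν : Measure ↥(adelicUnipotent F E c 2)) [ν.IsHaarMeasure] {𝓕 : Set ↥(adelicUnipotent F E c 2)}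
    (h𝓕 : IsFundamentalDomain ↥(rationalUnipotent F E c 2) 𝓕 ν) {T : ℝ≥0} (hT : 1 ≤ T) (φ₁ : (quasiSplit F E c 2).Adelic → ℂ)
    (Ec : ℂ → (quasiSplit F E c 2).Adelic → ℂ) {D : Set ℂ} (hD1 : ∀ᶠ z in 𝓝[≠] (1 : ℂ), z ∈ D)
    (hEcinv : ∀ z ∈ D, ∀ (γ : (quasiSplit F E c 2).arithmeticSubgroup) (x : (quasiSplit F E c 2).Adelic), Ec z ((γ : (quasiSplit F E c 2).Adelic) * x) = Ec z x)
    (ψ : ℂ → (quasiSplit F E c 2).Adelic → ℂ) {r : ℂ} (hψ : ∀ g : (quasiSplit F E c 2).Adelic, Tendsto (fun z : ℂ => (z - 1) * ψ z g) (𝓝[≠] 1) (𝓝 r))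
    (hE3 : ∀ z ∈ D, ∀ g : (quasiSplit F E c 2).Adelic,
      borelConstantTerm ν 𝓕 (Ec z) g = φ₁ g * (((borelHeight g : ℝ≥0) : ℝ) : ℂ) ^ z + ψ z g * (((borelHeight g : ℝ≥0) : ℝ) : ℂ) ^ (1 - z))
    (Fp : (quasiSplit F E c 2).Adelic → ℂ → ℂ) (hF : ∀ g, AnalyticAt ℂ (Fp g) 1) (hFE : ∀ g, Fp g =ᶠ[𝓝[≠] 1] fun z => (z - 1) * Ec z g)
    (Fam : ℂ → (quasiSplit F E c 2).L2 μ)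
    (hFam : ∀ z ∈ D, ((Fam z : (quasiSplit F E c 2).L2 μ) : (quasiSplit F E c 2).automorphicQuotient → ℂ) =ᵐ[μ] (quasiSplit F E c 2).quotFun (truncation ν 𝓕 T (Ec z)))
    (Res : (quasiSplit F E c 2).L2 μ) (hRes : Tendsto (fun z : ℂ => (z - 1) • Fam z) (𝓝[≠] 1) (𝓝 Res)) :
    ((Res : (quasiSplit F E c 2).L2 μ) : (quasiSplit F E c 2).automorphicQuotient → ℂ) =ᵐ[μ] fun x =>
      Fp (Quotient.out (x : (quasiSplit F E c 2).Adelic ⧸ (quasiSplit F E c 2).quotientSubgroup))⁻¹ 1 -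
        if T < supHeight F E c 2 x then r else 0 := by
  -- an a.e.-convergent sequence `zₙ → 1`, `zₙ ≠ 1`
  have hIM := tendstoInMeasure_of_tendsto_Lp hRes
  obtain ⟨ns, hns, hae⟩ := hIM.exists_seq_tendsto_ae'
  -- eventually `zₙ ∈ D`; along those `n` the representatives are `(zₙ−1)·Λ^T Ẽ(zₙ)` a.e.
  have hnsD : ∀ᶠ n in atTop, ns n ∈ D := hns.eventually hD1
  have hrep : ∀ᵐ x ∂μ, ∀ n, ns n ∈ D → (((ns n - 1) • Fam (ns n) : (quasiSplit F E c 2).L2 μ) : (quasiSplit F E c 2).automorphicQuotient → ℂ) x =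
      (ns n - 1) * (quasiSplit F E c 2).quotFun (truncation ν 𝓕 T (Ec (ns n))) x := by
    rw [ae_all_iff]
    intro n
    by_cases hn : ns n ∈ D
    · filter_upwards [Lp.coeFn_smul (ns n - 1) (Fam (ns n)), hFam (ns n) hn] with x hx hx'
      intro _
      rw [hx, Pi.smul_apply, hx', smul_eq_mul]
    · exact ae_of_all _ fun x h => absurd h hn
  filter_upwards [hae, hrep] with x hx hxrep
  set y : (quasiSplit F E c 2).Adelic := (Quotient.out (x : (quasiSplit F E c 2).Adelic ⧸ (quasiSplit F E c 2).quotientSubgroup))⁻¹ with hy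
  -- the pointwise limit along the sequence (§2 composed with `ns`)
  have hpt := (tendsto_sub_one_mul_truncation_continued_level ν h𝓕 hT φ₁ Ec hD1 hEcinv ψ hψ hE3 Fp hF hFE y).comp hns
  have hW : (⨆ γ : (quasiSplit F E c 2).arithmeticSubgroup, borelHeight ((γ : (quasiSplit F E c 2).Adelic) * y)) = supHeight F E c 2 x := by
    rw [supHeight_eq_ciSup_arithmetic]
  rw [hW] at hpt
  have hev : (fun n => (((ns n - 1) • Fam (ns n) : (quasiSplit F E c 2).L2 μ) : (quasiSplit F E c 2).automorphicQuotient → ℂ) x) =ᶠ[atTop]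
      ((fun z : ℂ => (z - 1) * truncation ν 𝓕 T (Ec z) y) ∘ ns) := by
    filter_upwards [hnsD] with n hn
    rw [hxrep n hn]
    rfl
  exact tendsto_nhds_unique (hx.congr' hev) hpt

end AE

end Summit.HodgeConjecture.HodgeConjecture.Cruxes.H413.K2E1ContinuedEisensteinResidueFunctionLevelUTwo

end
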